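import Literature.NumberTheory.Automorphic.QuaternionAlgebraAdelicInvolutionProofs
import HarnessLib

/-!
# Units and reduced norm of a quaternion algebra — discharge of `isUnit_iff_reducedNorm_ne_zero`

Sibling proof file of `Literature.NumberTheory.Automorphic.QuaternionAlgebraAdelic` (namespace
`Literature.Automorphic`), proving the named fact

* `isUnit_iff_reducedNorm_ne_zero` (Vignéras, LNM 800, Ch. I §1, **Lemme 1.1**: *les éléments
  inversibles de `H` sont les éléments de norme réduite non nulle … `n(h) ≠ 0` est équivalent à
  `h` inversible, et dans ce cas `h⁻¹ = h̄ n(h)⁻¹`*), as `isUnit_iff_reducedNorm_ne_zero_holds`,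

for an *abstract* quaternion algebra `D` over a field `K` of characteristic `0`
(`IsQuaternionAlgebra K D`: central simple of dimension `4`), with the reduced trace / standard
involution / reduced norm of the parent file (`reducedTrace = ½ Tr_{D/K}`, `x̄ = trd(x) - x`,
`nrd(x) = ¼ Tr_{D/K}(x x̄)`, `Tr_{D/K} = leftMulTrace`).

## Proof

The structural input is `exists_mul_self_eq_of_isQuaternionAlgebra` of the sibling file
`QuaternionAlgebraAdelicInvolutionProofs` (every `x ∈ D` satisfies `x² = t x - n` with
`Tr_{D/K}(x) = 2t`; Vignéras I §1 p. 2, via Wedderburn–Artin). From it `trd(x) = t`,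
`x̄ = t - x`, `x x̄ = x̄ x = n = nrd(x)` (`IsQuaternionAlgebra.reducedTrace_reducedNorm_eq_of_mul_self_eq`),
and Lemme 1.1 follows as printed: if `nrd(x) ≠ 0` then `nrd(x)⁻¹ x̄` is a two-sided inverse; if
`nrd(x) = 0` and `x` is a unit then `x̄ = x⁻¹ (x x̄) = 0`, so `x = trd(x) ∈ K`, and comparing
`Tr(L_x) = 4 trd(x)` with `Tr(L_x) = 2 trd(x)` (characteristic `0`) gives `x = 0`, not a unit.

Only `theorem`s are declared, so dependents keep consuming the fact as
`(h : isUnit_iff_reducedNorm_ne_zero K D)` fed with `isUnit_iff_reducedNorm_ne_zero_holds K D`.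

## References

* M.-F. Vignéras, *Arithmétique des algèbres de quaternions*, LNM 800 (1980), Ch. I §1, p. 2,
  Lemme 1.1. [VignerasLNM800]
-/

namespace Literature.NumberTheory.Automorphic

section IsUnitIffReducedNormProof

variable {K : Type*} {D : Type*} [Field K] [Ring D] [Algebra K D]

/-- Identification of the parent file's `reducedTrace`/`standardInvolution`/`reducedNorm` (trace
formulas) with the coefficients of the quadratic relation: if `x² = t x - n` and `Tr(L_x) = 2t`
then, in characteristic `0`, `trd(x) = t`, `x x̄ = x̄ x = n · 1` and `nrd(x) = n` (Vignéras I §1,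
p. 2: `t(h) = h + h̄`, `n(h) = h h̄ = h̄ h`, `T = 2t`). [cite: VignerasLNM800, Ch. I §1 p. 2] -/
theorem IsQuaternionAlgebra.reducedTrace_reducedNorm_eq_of_mul_self_eq [CharZero K]
    [IsQuaternionAlgebra K D] {x : D} {t n : K}
    (hx2 : x * x = algebraMap K D t * x - algebraMap K D n) (htr : leftMulTrace K D x = 2 * t) :
    reducedTrace K D x = t ∧ x * standardInvolution K D x = algebraMap K D n ∧
      standardInvolution K D x * x = algebraMap K D n ∧ reducedNorm K D x = n := by
  have htrd : reducedTrace K D x = t := by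
    simp only [reducedTrace, LinearMap.smul_apply, htr, smul_eq_mul]
    rw [← mul_assoc, inv_mul_cancel₀ two_ne_zero, one_mul]
  have hbar : standardInvolution K D x = algebraMap K D t - x := by
    rw [standardInvolution, htrd]
  have hmul : x * standardInvolution K D x = algebraMap K D n := by
    rw [hbar, mul_sub, ← Algebra.commutes, hx2, sub_sub_cancel]
  have hmul' : standardInvolution K D x * x = algebraMap K D n := by
    rw [hbar, sub_mul, hx2, sub_sub_cancel]
  refine ⟨htrd, hmul, hmul', ?_⟩
  rw [reducedNorm, hmul, leftMulTrace_algebraMap D n,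
    IsQuaternionAlgebra.finrank_eq_four (K := K) (D := D)]
  push_cast
  rw [mul_comm n, ← mul_assoc, inv_mul_cancel₀ (by norm_num : (4 : K) ≠ 0), one_mul]

/-- `x̄ x = nrd(x) · 1` in a quaternion algebra over a field of characteristic `0` (companion of
`mul_standardInvolution_holds`; Vignéras I §1, Lemme 1.1: `h⁻¹ = h̄ n(h)⁻¹` is a two-sided
inverse). [cite: VignerasLNM800, Ch. I §1 Lemme 1.1] -/
theorem IsQuaternionAlgebra.standardInvolution_mul [CharZero K] [IsQuaternionAlgebra K D] (x : D) :
    standardInvolution K D x * x = algebraMap K D (reducedNorm K D x) := by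
  obtain ⟨t, n, hx2, htr⟩ := exists_mul_self_eq_of_isQuaternionAlgebra (K := K) x
  obtain ⟨-, -, hmul', hnrd⟩ :=
    IsQuaternionAlgebra.reducedTrace_reducedNorm_eq_of_mul_self_eq hx2 htr
  rw [hnrd, hmul']

/-- If `nrd(x) ≠ 0` then `x` is a unit, with inverse `nrd(x)⁻¹ x̄` (Vignéras I §1, Lemme 1.1:
`h⁻¹ = h̄ n(h)⁻¹`). [cite: VignerasLNM800, Ch. I §1 Lemme 1.1] -/
theorem IsQuaternionAlgebra.isUnit_of_reducedNorm_ne_zero [CharZero K] [IsQuaternionAlgebra K D]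
    {x : D} (hx : reducedNorm K D x ≠ 0) : IsUnit x := by
  refine ⟨⟨x, (reducedNorm K D x)⁻¹ • standardInvolution K D x, ?_, ?_⟩, rfl⟩
  · rw [mul_smul_comm, mul_standardInvolution_holds K D, Algebra.algebraMap_eq_smul_one, smul_smul,
      inv_mul_cancel₀ hx, one_smul]
  · rw [smul_mul_assoc, IsQuaternionAlgebra.standardInvolution_mul, Algebra.algebraMap_eq_smul_one,
      smul_smul, inv_mul_cancel₀ hx, one_smul]

/-- **Discharge** of `isUnit_iff_reducedNorm_ne_zero` (Vignéras, LNM 800, Ch. I §1, **Lemme 1.1**: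
*les éléments inversibles de `H` sont les éléments de norme réduite non nulle*), for an abstract
quaternion algebra (`IsQuaternionAlgebra K D`: central simple of dimension `4`) over a field of
characteristic `0`. (⇐) `x · nrd(x)⁻¹ x̄ = nrd(x)⁻¹ x̄ · x = 1`
(`IsQuaternionAlgebra.isUnit_of_reducedNorm_ne_zero`). (⇒) if `nrd(x) = 0` then `x x̄ = 0`, so
for a unit `x`, `x̄ = 0`, i.e. `x = trd(x) ∈ K`; then `Tr(L_x) = 4 trd(x)` and `Tr(L_x) = 2 trd(x)`
force `x = 0`, which is not a unit (`D ≠ 0` as `dim_K D = 4`).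
[cite: VignerasLNM800, Ch. I §1 Lemme 1.1] -/
theorem isUnit_iff_reducedNorm_ne_zero_holds (K : Type*) (D : Type*) [Field K] [Ring D]
    [Algebra K D] : isUnit_iff_reducedNorm_ne_zero K D := by
  intro _ _ x
  refine ⟨fun hu hn0 => ?_, IsQuaternionAlgebra.isUnit_of_reducedNorm_ne_zero⟩
  obtain ⟨t, n, hx2, htr⟩ := exists_mul_self_eq_of_isQuaternionAlgebra (K := K) x
  obtain ⟨htrd, hmul, -, hnrd⟩ :=
    IsQuaternionAlgebra.reducedTrace_reducedNorm_eq_of_mul_self_eq hx2 htr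
  have h4 := IsQuaternionAlgebra.finrank_eq_four (K := K) (D := D)
  haveI : Nontrivial D := Module.nontrivial_of_finrank_pos (R := K) (by omega)
  rw [hnrd] at hn0
  rw [hn0, map_zero] at hmul
  have hbar0 : standardInvolution K D x = 0 := by
    obtain ⟨u, rfl⟩ := hu
    simpa using congrArg (fun z => (↑u⁻¹ : D) * z) hmul
  have hxt : x = algebraMap K D t := by
    rw [standardInvolution, htrd, sub_eq_zero] at hbar0
    exact hbar0.symm
  have ht0 : t = 0 := by
    rw [hxt, leftMulTrace_algebraMap D t, h4] at htr
    push_cast at htr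
    have h2t : (2 : K) * t = 0 := by linear_combination htr
    simpa using h2t
  rw [hxt, ht0, map_zero] at hu
  exact not_isUnit_zero hu

end IsUnitIffReducedNormProof

end Literature.NumberTheory.Automorphic
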